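import Literature.MathematicalPhysics.QuantumFieldTheory.Balaban1983to89.B7Ineq139Cplx
import Literature.MathematicalPhysics.QuantumFieldTheory.Balaban1983to89.B7Prop5CplxInduction
import Literature.MathematicalPhysics.QuantumFieldTheory.Balaban1983to89.B7Prop5GeneralLevels
import Literature.MathematicalPhysics.QuantumFieldTheory.Balaban1983to89.B7Prop7Levels

/-!
# `Balaban1983to89.B7Prop5CplxLevels` — T. Bałaban, *Averaging operations for lattice gauge theories*, Commun. Math. Phys.
**98** (1985) 17–51 [Balaban1985Averaging]: Proposition 5 EXTENDED TO THE COMPLEX BACKGROUND `U′U₀` (p. 43 «Similarly,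
Proposition 5 may be extended to include analyticity and uniformity statements. The formulations are obvious.») — file 4/5:
THE ONE-STEP INPUTS (139), (148), (131), linearity, locality DISCHARGED at every complex level background `Ũ′ʲŪ₀ʲ =
avgIter L (e^{B′}U₀) j` from Literature kernels (file 5 = `B7Prop5Cplx` assembles (147)/(156)/(157))

statement-level skeleton of published theorems with citation tags; proofs where landed; nothing here is a claim about the Yang–Mills mass gap

PDF held: `paper:balaban1985-cmp98-averaging` (journal page = PDF page + 16); pp. 39–43 [PDF 23–27] ((137)–(157), Props. 5–7)
read from the materialised text layer `~/.lit/texts/paper-balaban1985-cmp98-averaging/p0023.txt`–`p0027.txt`.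

CITATION HEADER / WHAT IS REPRODUCED.  SKELETON row **B7.Prop7** (cell `lit-balaban`, HOME `run/shared/lean/pub/lit-balaban/`,
seat p06 gen 4 = unit `lit-balaban-p06`; B7 owner r04, referee ref-4), located qualifier of ROWS-B7 v3.7 «the Prop. 5 extension
… not typed».  p. 43, verbatim: *"… we repeat the reasoning connected with Proposition 4, but with Ū₀ʲ replaced by \overline{U′U₀}ʲ
= Ũ′ʲŪ₀ʲ. Because of the bound (164), we have to replace the factors e^{O(1)L^{2(j+1)}η²α₀} by e^{O(1)(L^{2(j+1)}η²α₀ +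
L^{j+1}ηα₁)}, but this change is easily incorporated into the considerations and the estimates. We get the same results as before for
α₀, α₁ sufficiently small, uniformly in A′ … Proposition 7. For U₀ satisfying (52) and U′ = e^{iηA′}, |A′| < α₁, α₀, α₁
sufficiently small, the function Q_k(U′U₀, ηA) is analytic in complex variables A′, A, and Proposition 4 holds uniformly in A′.
Similarly, Proposition 5 may be extended to include analyticity and uniformity statements. The formulations are obvious."*

THE PRINTED ROUTE, FOLLOWED.  The inductions (143)–(147) / (149)–(155) at a general unit-valued background `W` are files 2–3
(`B7Prop5CplxLinear`, `B7Prop5CplxInduction`), PER BOND, from the displayed one-step inputs at the level backgrounds `W̄ʲ =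
avgIter L W j`, `j < k`, as HYPOTHESES.  THIS FILE supplies each of them at `W = e^{B′}U₀` (the `U′U₀` of Prop. 7, `U′ = e^{B′}`,
`B′ = ηA′`), where `W̄ʲ = Ũ′ʲŪ₀ʲ` (`B7Eq92Concrete.tildIter_mul`) with `Ū₀ʲ` unit-bounded and `O(L²α₀(Lʲη)²)`-regular (Props. 1–2,
`B7Prop7Levels.level_background_data`) and `‖Ũ′ʲ − 1‖, ‖(Ũ′ʲ)⁻¹ − 1‖ ≤ 400(d+1)Lʲb′` ((164) at every level,
`B7Prop7Levels.level_pert_data` — print's «Because of the bound (164) …»): `h139_cplx_levels` ← `B7Ineq139Cplx.ineq139_cplx` (file 1: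
(139) at `U″V₀`, three-term), `hadd/hsmul_cplx_levels` ← `B7Prop3GeneralTild.linQcov_add/_smul` (the complex loops lie in the log
domain, `B7Prop7Levels.level_loops_lt_one`), `hloc_cplx_levels` ← `B7Prop5GeneralLevels.Ccov_congr` (locality of (122) at ANY
background), `h148/hdiff_cplx_levels` ← §1 = (148) at `U″V₀` («Proposition 3 holds uniformly for V′V₀»: analyticity
`B7Prop7OneStep.Qcov_cplx_analyticAt_field` + (123) at the complex background `norm_Ccov_cplx_le_explicit` with `C₁′ = 16C₁` ⇒ (148)
by the second-order Cauchy estimate `B7Ineq148.ineq148Printed_of_123`, radius `c₃/8`, `C″₁ = 4C₁′L^{d+2}`), `h131_cplx_levels` ←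
`B7Prop7Levels.prop7_prop4_uniform` ((131) «uniformly in A′»).

DICTIONARY (as in `B7Prop7Levels`; lineage: `η`, `i` absorbed, `b′` plays `ηα₁` for `A′`, `b` plays `ηα₁` for `A`, every level
on `ℤᵈ`, `n = (2d+2)L` written `2 * (d * L) + L + L`): the level sequences of files 2–3 at `W = e^{B′}U₀` are
`ε_j = epsCplx d L b′ j = 6·n·400(d+1)Lʲb′` (transport excess of (139) at `Ũ′ʲŪ₀ʲ`), `τ_j = tauCplx d L α₀ k b′ j =
(140·32(d+1)(d+4)L²α₀(Lʲ/Lᵏ)² + 280·n·400(d+1)Lʲb′)·Lᵈ/L` (the `Q″`-coefficient: print's «O(1)(L^{2(j+1)}η²α₀ + L^{j+1}ηα₁)»),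
`C″ = C1ppCplx d L = 4·2097152(d+1)²·L^{d+2}`, `C₃ = C3Cplx d L = 16·C1ppCplx d L` («C₃ > C″₁»).  HYPOTHESES (verbatim those of
`B7Prop7Levels` §2): `L ≥ 2`; `U₀` in an averaging-closed `G ⊂ U1`; (52) `pdev U₀ < α₀L^{−2k}`, `C₀α₀ ≤ 1/3`, `8α₀ ≤ c₂′(d,L)`;
`sup‖B′‖ ≤ b′` with `e^{4cα₀}(1 + 8C₁Lᵏb′) ≤ 2`, `2Lᵏb′ ≤ c₃`, `409600(d+1)²Lᵏb′ ≤ 1` («α₁ sufficiently small» for `A′`); for (131):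
`sup‖B‖ ≤ b` with `e^{E}(1 + 8C₁′Lᵏb) ≤ 2`, `16Lᵏb < c₃` (field smallness).

WHAT THIS FILE PROVES (kernel, 0 sorry, standard axioms): §1 (148) AT THE COMPLEX BACKGROUND `U″V₀` on the insertion space `𝔸^S`
(`analyticOnNhd_Qcov_cplx_insCfg`, `linQcov_cplx_insCfg_eq_fderiv`, `differentiableOn_Ccov_cplx_insCfg`, `norm_Ccov_cplx_insCfg_le`,
**`ineq148_cplx`**); §2 the constants `epsCplx`, `tauCplx`, `C1ppCplx`, `C3Cplx` (with signs); §3 THE LEVEL DISCHARGES at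
`avgIter L (e^{B′}U₀) j`, `j < k`: `hadd_cplx_levels`, `hsmul_cplx_levels`, **`h139_cplx_levels`** (three-term (139)ⱼ with
`ε_j = epsCplx`, `τ_j = tauCplx`), `hloc_cplx_levels`, **`h148_cplx_levels`** (radius `c₃/8`, `C″ = C1ppCplx`), `hdiff_cplx_levels`,
**`h131_cplx_levels`** + `hrho_cplx_levels` — LITERALLY the binders of `B7Prop5CplxLinear.ineq143_cplx` / `B7Prop5CplxInduction.ineq149_cplx`.
DIVERGENCES from print: constants are admissible witnesses, not optimal; radius of (148) `c₃/8`; thresholds displayed and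
`d`-dependent as in `B7Prop7Levels`; `ℤᵈ`, corner blocks, `U1`/`AvgClosed` background as in the lineage.
-/

noncomputable section

open scoped BigOperators
open NormedSpace Finset Metric Set

namespace Literature.MathematicalPhysics.QuantumFieldTheory.Balaban1983to89.B7Prop5CplxLevels

open B7Prop1Explicit B7Prop1Local B7Prop2Explicit B7Prop3Flat B7Prop4Flat B7Eq92Concrete MatrixLog B7Prop3GeneralLinear
  B7Prop3GeneralAnalytic B7Prop4GeneralLevels B7Ineq148 B7Prop5GeneralOperators B7Eq123General B7Prop7OneStep B7Prop7Levels
  B7Ineq139Cplx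
open B7Prop5Flat (S1 agreeOn_expCfg)
open B7Prop3GeneralTild (linQcov_add linQcov_smul)
open B7Prop5GeneralLevels (Ccov_congr)

-- `Site` alone would resolve to the torus sites of `Setup.lean`; re-export the `ℤ^d` sites of `B7Prop1Explicit`.
export B7Prop1Explicit (Site)

variable {d : ℕ}
variable {𝔸 : Type*} [NormedRing 𝔸] [NormedAlgebra ℂ 𝔸] [CompleteSpace 𝔸] [NormOneClass 𝔸]

/-! ## §1 (148) at the complex background `U″V₀`, on the insertion space `𝔸^S` -/

section OneStep

variable {L : ℕ} (hL : 1 ≤ L) {V₀ U'' : Site d → Fin d → 𝔸ˣ} (hV₀ : ∀ x κ, V₀ x κ ∈ U1 𝔸) {u : ℝ} (hu : 0 ≤ u)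
  (hU : ∀ x κ, ‖((U'' x κ : 𝔸ˣ) : 𝔸) - 1‖ ≤ u ∧ ‖(((U'' x κ)⁻¹ : 𝔸ˣ) : 𝔸) - 1‖ ≤ u)
  (hun : ((2 * (d * L) + L + L : ℕ) : ℝ) * u ≤ 1 / 512)
  (q : Site d) (κ : Fin d) {α : ℝ} (hα1 : α ≤ 1 / 128)
  (hreg : ∀ r : Fin d → Fin L, ‖((Wcx L V₀ q κ (boxVec L r) : 𝔸ˣ) : 𝔸) - 1‖ ≤ α)

omit [CompleteSpace 𝔸] [NormOneClass 𝔸] in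
include hL hun in
/-- print's thresholds in the `θ`-currency: `a ≤ c₃(d, L)/4 = 1/(512(d+1)L)` and `(2d+2)L·u ≤ 1/512` give `(2d+2)L·(a + 2u) ≤ 1/128`
(the private arithmetic of `B7Prop7OneStep`, re-derived). [cite: Balaban1985Averaging, Proposition 7 p.43] -/
private theorem theta_le_cplx {a : ℝ} (hac : a ≤ c3 d L / 4) :
    ((2 * (d * L) + L + L : ℕ) : ℝ) * (a + 2 * u) ≤ 1 / 128 := by
  have hL1 : (1 : ℝ) ≤ L := by exact_mod_cast hL
  have hcast : ((2 * (d * L) + L + L : ℕ) : ℝ) = 2 * ((d : ℝ) + 1) * L := by push_cast; ring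
  have hpos : (0 : ℝ) < 128 * ((d : ℝ) + 1) * L := by positivity
  have h1 : 2 * ((d : ℝ) + 1) * L * a ≤ 1 / 256 := by
    have := mul_le_mul_of_nonneg_left hac (by positivity : (0 : ℝ) ≤ 2 * ((d : ℝ) + 1) * L)
    refine this.trans (le_of_eq ?_)
    rw [c3]; field_simp; ring
  rw [hcast] at hun ⊢
  nlinarith

include hL hV₀ hu hU hun hα1 hreg in
/-- **«Proposition 3 holds uniformly for V′V₀», THE ANALYTICITY THROUGH THE INSERTION**: for every finite bond set `S`,
`a ↦ Q(U″V₀, ins_S a, c)` is analytic on a neighbourhood of every point of the polydisc `‖a‖ < c₃(d, L)/4`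
(`B7Prop7OneStep.Qcov_cplx_analyticAt_field` along `insCfg`; `U1` twin `B7Ineq148General.analyticOnNhd_Qcov_insCfg`).
[cite: Balaban1985Averaging, Proposition 7 p.43, Proposition 3 (121) p.36] -/
theorem analyticOnNhd_Qcov_cplx_insCfg (S : Finset (Site d × Fin d)) :
    AnalyticOnNhd ℂ (fun a : S → 𝔸 => Qcov L (U'' * V₀) (insCfg S a) q κ) (ball 0 (c3 d L / 4)) := fun a₀ ha => by
  rw [mem_ball_zero_iff] at ha
  exact Qcov_cplx_analyticAt_field (fun a : S → 𝔸 => insCfg S a) (fun x μ => analyticAt_insCfg S x μ a₀) hL hV₀ hu hU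
    (norm_nonneg a₀) (fun x μ => norm_insCfg_le S a₀ x μ) (theta_le_cplx hL hun ha.le) (by norm_num) le_rfl q κ hα1 hreg

include hL hV₀ hu hU hun hα1 hreg in
/-- the linear part through the insertion IS the Fréchet derivative at `0`: `L(Q(U″V₀) ins_S a)_c = D[a ↦ Q(U″V₀, ins_S a, c)](0)·a`.
[cite: Balaban1985Averaging, (122) p.36, Proposition 7 p.43] -/
theorem linQcov_cplx_insCfg_eq_fderiv (S : Finset (Site d × Fin d)) (a : S → 𝔸) :
    linQcov L (U'' * V₀) (insCfg S a) q κ = fderiv ℂ (fun a : S → 𝔸 => Qcov L (U'' * V₀) (insCfg S a) q κ) 0 a := by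
  have hd : DifferentiableAt ℂ (fun a : S → 𝔸 => Qcov L (U'' * V₀) (insCfg S a) q κ) 0 :=
    (analyticOnNhd_Qcov_cplx_insCfg hL hV₀ hu hU hun q κ hα1 hreg S 0
      (mem_ball_self (by linarith [c3_pos d hL]))).differentiableAt
  rw [← dPair_eq_fderiv hd]
  unfold linQcov dPair
  have h : (fun t : ℂ => Qcov L (U'' * V₀) (t • insCfg S a) q κ)
      = fun t : ℂ => Qcov L (U'' * V₀) (insCfg S ((0 : S → 𝔸) + t • a)) q κ :=
    funext fun t => by rw [zero_add, insCfg_smul]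
  rw [h]

include hL hV₀ hu hU hun hα1 hreg in
/-- `a ↦ C(U″V₀, ins_S a, c)` is `ℂ`-differentiable on the polydisc `‖a‖ < c₃(d, L)/4`. [cite: Balaban1985Averaging, Proposition 3 (121)–(122) p.36, Proposition 7 p.43] -/
theorem differentiableOn_Ccov_cplx_insCfg (S : Finset (Site d × Fin d)) :
    DifferentiableOn ℂ (fun a : S → 𝔸 => Ccov L (U'' * V₀) (insCfg S a) q κ) (ball 0 (c3 d L / 4)) := by
  have h : (fun a : S → 𝔸 => linQcov L (U'' * V₀) (insCfg S a) q κ)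
      = fun a => fderiv ℂ (fun a : S → 𝔸 => Qcov L (U'' * V₀) (insCfg S a) q κ) 0 a :=
    funext fun a => linQcov_cplx_insCfg_eq_fderiv hL hV₀ hu hU hun q κ hα1 hreg S a
  have hlin : Differentiable ℂ (fun a : S → 𝔸 => linQcov L (U'' * V₀) (insCfg S a) q κ) := by
    rw [h]; exact (fderiv ℂ (fun a : S → 𝔸 => Qcov L (U'' * V₀) (insCfg S a) q κ) 0).differentiable
  show DifferentiableOn ℂ (fun a : S → 𝔸 => Qcov L (U'' * V₀) (insCfg S a) q κ - linQcov L (U'' * V₀) (insCfg S a) q κ)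
    (ball 0 (c3 d L / 4))
  exact (analyticOnNhd_Qcov_cplx_insCfg hL hV₀ hu hU hun q κ hα1 hreg S).differentiableOn.sub hlin.differentiableOn

include hL hV₀ hu hU hun hα1 hreg in
/-- **(123) AT THE COMPLEX BACKGROUND ON THE INSERTION SPACE**: `‖C(U″V₀, ins_S a, c)‖ ≤ C₁′L²‖a‖²` for `‖a‖ ≤ c₃(d, L)/4`,
`C₁′ = 2097152(d+1)² = 16C₁` (`B7Prop7OneStep.norm_Ccov_cplx_le_explicit`). [cite: Balaban1985Averaging, Proposition 3 (123) p.36, Proposition 7 p.43] -/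
theorem norm_Ccov_cplx_insCfg_le (S : Finset (Site d × Fin d)) {a : S → 𝔸} (ha : ‖a‖ ≤ c3 d L / 4) :
    ‖Ccov L (U'' * V₀) (insCfg S a) q κ‖ ≤ 2097152 * ((d : ℝ) + 1) ^ 2 * (L : ℝ) ^ 2 * ‖a‖ ^ 2 :=
  norm_Ccov_cplx_le_explicit hL hV₀ hu hU hun (insCfg S a) (norm_nonneg a) (fun x μ => norm_insCfg_le S a x μ) ha q κ
    hα1 hreg

include hL hV₀ hu hU hun hα1 hreg in
/-- **(148) AT THE COMPLEX BACKGROUND `U″V₀`, ON THE INSERTION SPACE** — «|⟨δC(V₀, A)/δA, δA⟩| ≤ C″₁|A|Q″|δA|» rerun «uniformly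
for V′V₀»: for `C = C(U″V₀, ·, c)` read on `𝔸^S`, ANY finite `S`: `Ineq148Printed` with radius `c₃(d, L)/8` and `C″₁ =
4·C₁′·L^{d+2}`, `C₁′ = 2097152(d+1)²` — (123) at the complex background + analyticity ⇒ (148) by the second-order Cauchy estimate
(`B7Ineq148.ineq148Printed_of_123`; `U1` twin `B7Ineq148General.ineq148_general`). [cite: Balaban1985Averaging, (148) p.40, Proposition 7 p.43, Proposition 3 (121)–(123) p.36] -/
theorem ineq148_cplx (S : Finset (Site d × Fin d)) :
    Ineq148Printed (fun a : S → 𝔸 => Ccov L (U'' * V₀) (insCfg S a) q κ) (L : ℝ) d (c3 d L / 8)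
      (4 * (2097152 * ((d : ℝ) + 1) ^ 2) * (L : ℝ) ^ (d + 2)) := by
  have hL0 : (0 : ℝ) < L := by exact_mod_cast hL
  have h := ineq148Printed_of_123 (d := d) (c₃ := c3 d L / 4) hL0 (by positivity)
    (differentiableOn_Ccov_cplx_insCfg hL hV₀ hu hU hun q κ hα1 hreg S)
    (fun a ha => norm_Ccov_cplx_insCfg_le hL hV₀ hu hU hun q κ hα1 hreg S
      (le_of_lt (by rwa [mem_ball_zero_iff] at ha)))
  have e : c3 d L / 4 / 2 = c3 d L / 8 := by ring
  rwa [e] at h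

end OneStep

/-! ## §2 The constants at the complex background -/

/-- the transport excess `ε_j` of (139) at `Ũ′ʲŪ₀ʲ`: `6·(2d+2)L·400(d+1)·Lʲb′` (`B7Ineq139Cplx.ineq139_cplx`'s `6s` with (164)'s
`u = 400(d+1)Lʲb′`) — print's extra level exponent «L^{j+1}ηα₁». [cite: Balaban1985Averaging, Proposition 7 p.43, (164) p.43, (139) p.39] -/
def epsCplx (d L : ℕ) (b' : ℝ) (j : ℕ) : ℝ :=
  6 * (((2 * (d * L) + L + L : ℕ) : ℝ) * (400 * ((d : ℝ) + 1) * ((L : ℝ) ^ j * b')))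

/-- the `Q″`-coefficient `τ_j` of (139) at `Ũ′ʲŪ₀ʲ` (so that `τ_j·L·Q″` is `B7Ineq139Cplx.ineq139_cplx`'s `(140α_j + 280s_j)·Lᵈ·Q″`):
`α_j = 32(d+1)(d+4)L²·α₀(Lʲ/Lᵏ)²` (block loops of `Ū₀ʲ`, Props. 1–2), `s_j = (2d+2)L·400(d+1)Lʲb′` ((164)) — print's
«O(1)(L^{2(j+1)}η²α₀ + L^{j+1}ηα₁)» replacing «C′₁2α₀(Lʲη)²» in (144). [cite: Balaban1985Averaging, Proposition 7 p.43, (144) p.40] -/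
def tauCplx (d L : ℕ) (α₀ : ℝ) (k : ℕ) (b' : ℝ) (j : ℕ) : ℝ :=
  (140 * (32 * ((d : ℝ) + 1) * ((d : ℝ) + 4) * (L : ℝ) ^ 2 * (α₀ * ((L : ℝ) ^ j * ((L : ℝ) ^ k)⁻¹) ^ 2))
      + 280 * (((2 * (d * L) + L + L : ℕ) : ℝ) * (400 * ((d : ℝ) + 1) * ((L : ℝ) ^ j * b'))))
    * (L : ℝ) ^ d * (L : ℝ)⁻¹

/-- print's `C″₁` of (148) at the complex background: `4·C₁′·L^{d+2}`, `C₁′ = 2097152(d+1)² = 16C₁` (§1 `ineq148_cplx`).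
[cite: Balaban1985Averaging, (148) p.40, Proposition 7 p.43] -/
def C1ppCplx (d L : ℕ) : ℝ := 4 * (2097152 * ((d : ℝ) + 1) ^ 2) * (L : ℝ) ^ (d + 2)

/-- print's `C₃` of (149)/(157) at the complex background («C₃ > C″₁ … e.g. we may take C₃ = 6C″₁»; the per-bond bookkeeping
takes `16C″₁`). [cite: Balaban1985Averaging, (155) p.41, Prop. 5 p.42, Proposition 7 p.43] -/
def C3Cplx (d L : ℕ) : ℝ := 16 * C1ppCplx d L

/-- `epsCplx ≥ 0` for `b′ ≥ 0`. [cite: Balaban1985Averaging, Proposition 7 p.43] -/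
theorem epsCplx_nonneg (d L : ℕ) {b' : ℝ} (hb' : 0 ≤ b') (j : ℕ) : 0 ≤ epsCplx d L b' j := by
  unfold epsCplx; positivity

/-- `tauCplx ≥ 0` for `α₀, b′ ≥ 0`. [cite: Balaban1985Averaging, Proposition 7 p.43] -/
theorem tauCplx_nonneg (d L : ℕ) {α₀ : ℝ} (hα : 0 ≤ α₀) (k : ℕ) {b' : ℝ} (hb' : 0 ≤ b') (j : ℕ) :
    0 ≤ tauCplx d L α₀ k b' j := by
  unfold tauCplx; positivity

/-- `C1ppCplx > 0` (`L ≥ 1`). [cite: Balaban1985Averaging, (148) p.40] -/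
theorem C1ppCplx_pos (d : ℕ) {L : ℕ} (hL : 1 ≤ L) : 0 < C1ppCplx d L := by
  have : (0 : ℝ) < L := by exact_mod_cast hL
  unfold C1ppCplx; positivity

/-- `C3Cplx > 0` (`L ≥ 1`). [cite: Balaban1985Averaging, (155) p.41] -/
theorem C3Cplx_pos (d : ℕ) {L : ℕ} (hL : 1 ≤ L) : 0 < C3Cplx d L := by
  have := C1ppCplx_pos d hL; unfold C3Cplx; positivity

/-- `2C″/C₃ = 1/8` for `C₃ = 16C″`. [cite: Balaban1985Averaging, (155) p.41] -/
theorem two_mul_C1ppCplx_div_C3Cplx (d : ℕ) {L : ℕ} (hL : 1 ≤ L) : 2 * C1ppCplx d L / C3Cplx d L = 1 / 8 := by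
  have := C1ppCplx_pos d hL
  rw [C3Cplx]; field_simp; ring

/-! ## §3 The per-level discharges at the complex backgrounds `avgIter L (e^{B′}U₀) j = Ũ′ʲŪ₀ʲ` -/

section Regime

variable (L : ℕ) (hL : 2 ≤ L) {G : Subgroup 𝔸ˣ} (hG : AvgClosed d L G) (k : ℕ)
  (U₀ : Site d → Fin d → 𝔸ˣ) (hU₀ : ∀ x κ, U₀ x κ ∈ G) {α₀ : ℝ} (hα : 0 < α₀)
  (hα3 : C0 d * α₀ ≤ 1 / 3) (hα8 : 8 * α₀ ≤ c2' d L) (h52 : pdev U₀ < α₀ * (((L : ℝ) ^ k)⁻¹) ^ 2)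
  (B' : Site d → Fin d → 𝔸) {b' : ℝ} (hb' : 0 ≤ b') (hB' : ∀ x κ, ‖B' x κ‖ ≤ b')
  (hsmall' : Real.exp (4 * (800 * ((d : ℝ) + 1) ^ 2 * ((d : ℝ) + 4)) * α₀)
    * (1 + 8 * (131072 * ((d : ℝ) + 1) ^ 2) * ((L : ℝ) ^ k * b')) ≤ 2)
  (hc₃' : 2 * ((L : ℝ) ^ k * b') ≤ c3 d L) (hb'1 : 409600 * ((d : ℝ) + 1) ^ 2 * ((L : ℝ) ^ k * b') ≤ 1)

omit [NormOneClass 𝔸] in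
/-- the complex level background IS `Ũ′ʲ·Ū₀ʲ` (69): `avgIter L (e^{B′}U₀) j = tildIter L U₀ e^{B′} j · avgIter L U₀ j`
(`B7Eq92Concrete.tildIter_mul`) — print's «with Ū₀ʲ replaced by \overline{U′U₀}ʲ = Ũ′ʲŪ₀ʲ». [cite: Balaban1985Averaging, Proposition 7 p.43, (69) p.29] -/
theorem avgIter_cplx_eq (j : ℕ) :
    avgIter L (expCfg B' * U₀) j = tildIter L U₀ (expCfg B') j * avgIter L U₀ j :=
  (tildIter_mul L U₀ (expCfg B') j).symm

include hL hG hU₀ hα hα3 hα8 h52 hb' hB' hsmall' hc₃' hb'1 in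
/-- **`hadd` at the complex levels**: the one-step linear part at `Ũ′ʲŪ₀ʲ` is additive (the complex loops lie in the log domain,
`B7Prop7Levels.level_loops_lt_one`; `B7Prop3GeneralTild.linQcov_add`). [cite: Balaban1985Averaging, (122) p.36, Proposition 7 p.43] -/
theorem hadd_cplx_levels : ∀ j < k, ∀ (F F' : Site d → Fin d → 𝔸) (z : Site d) (κ : Fin d),
    linQcov L (avgIter L (expCfg B' * U₀) j) (F + F') ((L : ℤ) • z) κ =
      linQcov L (avgIter L (expCfg B' * U₀) j) F ((L : ℤ) • z) κ
        + linQcov L (avgIter L (expCfg B' * U₀) j) F' ((L : ℤ) • z) κ := by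
  intro j hj F F' z κ
  rw [avgIter_cplx_eq]
  exact linQcov_add L _ F F' ((L : ℤ) • z) κ
    (level_loops_lt_one L hL hG k U₀ hU₀ hα hα3 hα8 h52 B' hb' hB' hsmall' hc₃' hb'1 hj _ κ)

include hL hG hU₀ hα hα3 hα8 h52 hb' hB' hsmall' hc₃' hb'1 in
/-- **`hsmul` at the complex levels**: the one-step linear part at `Ũ′ʲŪ₀ʲ` is `ℂ`-homogeneous (`B7Prop3GeneralTild.linQcov_smul`).
[cite: Balaban1985Averaging, (122) p.36, Proposition 7 p.43] -/
theorem hsmul_cplx_levels : ∀ j < k, ∀ (t : ℂ) (F : Site d → Fin d → 𝔸) (z : Site d) (κ : Fin d),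
    linQcov L (avgIter L (expCfg B' * U₀) j) (t • F) ((L : ℤ) • z) κ
      = t • linQcov L (avgIter L (expCfg B' * U₀) j) F ((L : ℤ) • z) κ := by
  intro j hj t F z κ
  rw [avgIter_cplx_eq]
  exact linQcov_smul L _ t F ((L : ℤ) • z) κ
    (level_loops_lt_one L hL hG k U₀ hU₀ hα hα3 hα8 h52 B' hb' hB' hsmall' hc₃' hb'1 hj _ κ)

include hL hG hU₀ hα hα3 hα8 h52 hb' hB' hsmall' hc₃' hb'1 in
/-- **`h139` at the complex levels — THE THREE-TERM MAJORANT (139) AT `Ũ′ʲŪ₀ʲ`** (`B7Ineq139Cplx.ineq139_cplx` with `V₀ = Ū₀ʲ`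
unit-bounded and `32(d+1)(d+4)L²α₀(Lʲ/Lᵏ)²`-regular (Props. 1–2) and `U″ = Ũ′ʲ` within `400(d+1)Lʲb′` of `1` ((164) per level)):
`‖L(Q(Ũ′ʲŪ₀ʲ)G)_c‖ ≤ (1 + ε_j)·avQ L |G| (c) + τ_j·L·ddQ L |G| (c)`, `ε_j = epsCplx d L b′ j`, `τ_j = tauCplx d L α₀ k b′ j` —
print's (144) with «C′₁2α₀(Lʲη)²» replaced by «O(1)(L^{2(j+1)}η²α₀ + L^{j+1}ηα₁)» and the main term acquiring «|W||W⁻¹|».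
[cite: Balaban1985Averaging, (139) p.39, (144) p.40, Proposition 7 p.43] -/
theorem h139_cplx_levels : ∀ j < k, ∀ (G' : Site d → Fin d → 𝔸) (z : Site d) (κ : Fin d),
    ‖linQcov L (avgIter L (expCfg B' * U₀) j) G' ((L : ℤ) • z) κ‖ ≤
      (1 + epsCplx d L b' j) * avQ L (fun x κ' => ‖G' x κ'‖) ((L : ℤ) • z) κ
        + tauCplx d L α₀ k b' j * (L : ℝ) * ddQ L (fun x κ' => ‖G' x κ'‖) ((L : ℤ) • z) κ := by
  intro j hj G' z κ
  have hL1 : 1 ≤ L := le_trans (by norm_num) hL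
  have hL0 : (L : ℝ) ≠ 0 := by exact_mod_cast (by omega : L ≠ 0)
  have hα4 : 4 * α₀ ≤ c2' d L := by linarith
  obtain ⟨hV, hloops⟩ := level_background_data L hL hG k U₀ hU₀ hα hα3 hα8 h52 j hj.le
  obtain ⟨hreg, hα1⟩ := hloops ((L : ℤ) • z) κ
  have hU := level_pert_data L hL hG k U₀ hU₀ hα hα3 hα4 h52 B' hb' hB' hsmall' hc₃' hb'1 j hj.le
  have hnu := level_nu_le L hL k hb' hb'1 hj
  rw [avgIter_cplx_eq]
  have h := ineq139_cplx L hL1 hV (by positivity) hU hnu G' ((L : ℤ) • z) κ (hα1.trans (by norm_num)) hreg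
  refine h.trans (le_of_eq ?_)
  rw [epsCplx, tauCplx]
  field_simp

omit [NormOneClass 𝔸] in
include hL in
/-- **`hloc` at the complex levels** — LOCALITY of `C(Ũ′ʲŪ₀ʲ, ·)(c)` in the bonds of `B(c₋) ∪ B(c₊)` (`B7Prop5GeneralLevels.Ccov_congr`,
valid at ANY background). [cite: Balaban1985Averaging, p.34, p.31 (after (91)), Proposition 7 p.43] -/
theorem hloc_cplx_levels : ∀ j < k, ∀ (F F' : Site d → Fin d → 𝔸) (z : Site d) (κ : Fin d),
    AgreeOn ((L : ℤ) • z) (bondHi L ((L : ℤ) • z) κ) F F' →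
      Ccov L (avgIter L (expCfg B' * U₀) j) F ((L : ℤ) • z) κ = Ccov L (avgIter L (expCfg B' * U₀) j) F' ((L : ℤ) • z) κ :=
  fun _ _ _ _ _ κ h => Ccov_congr L (le_trans (by norm_num) hL) _ κ (fun _ _ _ _ => rfl) h

include hL hG hU₀ hα hα3 hα8 h52 hb' hB' hsmall' hc₃' hb'1 in
/-- **`h148` at the complex levels** — (148) for `C(Ũ′ʲŪ₀ʲ, ·, c)` on the box variables `𝔸^{S1}` with radius `c₃/8` and `C″₁ =
C1ppCplx d L` (§1 `ineq148_cplx` at `V₀ = Ū₀ʲ`, `U″ = Ũ′ʲ`). [cite: Balaban1985Averaging, (148) p.40, Proposition 7 p.43] -/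
theorem h148_cplx_levels : ∀ j < k, ∀ (z : Site d) (κ : Fin d),
    Ineq148Printed (fun a : ↥(S1 L ((L : ℤ) • z) κ) → 𝔸 =>
      Ccov L (avgIter L (expCfg B' * U₀) j) (insCfg (S1 L ((L : ℤ) • z) κ) a) ((L : ℤ) • z) κ) (L : ℝ) d (c3 d L / 8)
      (C1ppCplx d L) := by
  intro j hj z κ
  have hL1 : 1 ≤ L := le_trans (by norm_num) hL
  have hα4 : 4 * α₀ ≤ c2' d L := by linarith
  obtain ⟨hV, hloops⟩ := level_background_data L hL hG k U₀ hU₀ hα hα3 hα8 h52 j hj.le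
  obtain ⟨hreg, hα1⟩ := hloops ((L : ℤ) • z) κ
  have hU := level_pert_data L hL hG k U₀ hU₀ hα hα3 hα4 h52 B' hb' hB' hsmall' hc₃' hb'1 j hj.le
  have hnu := level_nu_le L hL k hb' hb'1 hj
  rw [avgIter_cplx_eq]
  exact ineq148_cplx hL1 hV (by positivity) hU hnu _ κ hα1 hreg _

include hL hG hU₀ hα hα3 hα8 h52 hb' hB' hsmall' hc₃' hb'1 in
/-- **`hdiff` at the complex levels** — differentiability of `a ↦ C(Ũ′ʲŪ₀ʲ, ins a, c)` at the points `‖a‖ < c₃/8`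
(`differentiableOn_Ccov_cplx_insCfg` on the ball of radius `c₃/4`). [cite: Balaban1985Averaging, Proposition 3 p.36, (148) p.40, Proposition 7 p.43] -/
theorem hdiff_cplx_levels : ∀ j < k, ∀ (z : Site d) (κ : Fin d) (a : ↥(S1 L ((L : ℤ) • z) κ) → 𝔸), ‖a‖ < c3 d L / 8 →
    DifferentiableAt ℂ (fun a : ↥(S1 L ((L : ℤ) • z) κ) → 𝔸 =>
      Ccov L (avgIter L (expCfg B' * U₀) j) (insCfg (S1 L ((L : ℤ) • z) κ) a) ((L : ℤ) • z) κ) a := by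
  intro j hj z κ a ha
  have hL1 : 1 ≤ L := le_trans (by norm_num) hL
  have hα4 : 4 * α₀ ≤ c2' d L := by linarith
  obtain ⟨hV, hloops⟩ := level_background_data L hL hG k U₀ hU₀ hα hα3 hα8 h52 j hj.le
  obtain ⟨hreg, hα1⟩ := hloops ((L : ℤ) • z) κ
  have hU := level_pert_data L hL hG k U₀ hU₀ hα hα3 hα4 h52 B' hb' hB' hsmall' hc₃' hb'1 j hj.le
  have hnu := level_nu_le L hL k hb' hb'1 hj
  rw [avgIter_cplx_eq]
  refine (differentiableOn_Ccov_cplx_insCfg hL1 hV (by positivity) hU hnu _ κ hα1 hreg _).differentiableAt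
    (isOpen_ball.mem_nhds ?_)
  rw [mem_ball_zero_iff]
  linarith [c3_pos d hL1]

variable (B : Site d → Fin d → 𝔸) {b : ℝ} (hb : 0 ≤ b) (hB : ∀ x κ, ‖B x κ‖ ≤ b)
  (hsmall : Real.exp (4480 * ((d : ℝ) + 1) ^ 2 * ((d : ℝ) + 4) * α₀ + 240000 * ((d : ℝ) + 1) ^ 3 * ((L : ℝ) ^ k * b'))
    * (1 + 8 * (2097152 * ((d : ℝ) + 1) ^ 2) * ((L : ℝ) ^ k * b)) ≤ 2)
  (hc₃ : 16 * ((L : ℝ) ^ k * b) < c3 d L)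

include hL hG hU₀ hα hα3 hα8 h52 hb' hB' hsmall' hc₃' hb'1 hb hB hsmall hc₃ in
/-- **`h131` at the complex levels — (131) «UNIFORMLY IN A′»** at every earlier level: `‖Q_j(U′U₀, ηB)(c)‖ ≤ 2Lʲb`, `j < k`
(`B7Prop7Levels.prop7_prop4_uniform`, r04 gen 4 = Proposition 7's «Proposition 4 holds uniformly in A′»).
[cite: Balaban1985Averaging, Proposition 7 p.43, (131) p.38] -/
theorem h131_cplx_levels :
    ∀ j < k, ∀ (x : Site d) (κ : Fin d), ‖logCovIter L (expCfg B' * U₀) B j x κ‖ ≤ 2 * ((L : ℝ) ^ j * b) := by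
  have hLkb : 0 ≤ (L : ℝ) ^ k * b := by positivity
  have hc₃4 : 2 * ((L : ℝ) ^ k * b) ≤ c3 d L / 4 := by linarith
  exact fun j hj => (prop7_prop4_uniform L hL hG k U₀ hU₀ hα hα3 hα8 h52 B' hb' hB' hsmall' hc₃' hb'1 B hb hB hsmall
    hc₃4 j hj.le).2

omit [CompleteSpace 𝔸] [NormOneClass 𝔸] in
include hL hb hc₃ in
/-- the radius bookkeeping of (148)'s domain at the complex background: `2Lʲb < c₃/8` for `j < k` (from `16Lᵏb < c₃`).
[cite: Balaban1985Averaging, p.41 (after (152)), Proposition 7 p.43] -/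
theorem hrho_cplx_levels : ∀ j < k, 2 * ((L : ℝ) ^ j * b) < c3 d L / 8 := by
  intro j hj
  have hL1r : (1 : ℝ) ≤ L := by exact_mod_cast le_trans (by norm_num) hL
  have hjk : (L : ℝ) ^ j * b ≤ (L : ℝ) ^ k * b := mul_le_mul_of_nonneg_right (pow_le_pow_right₀ hL1r hj.le) hb
  linarith

end Regime

end Literature.MathematicalPhysics.QuantumFieldTheory.Balaban1983to89.B7Prop5CplxLevels

end
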